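import Summits.QuantumFields.YangMills.Theorems.UnitScaleTiltProp7CovCombMeanPoincare
import Summits.QuantumFields.YangMills.Theorems.UnitScaleTiltProp7CombMeanCentred
import HarnessLib

/-!
# Route `UnitScaleTilt`, crux «MinimiserStabilityRegPr» (stmt-QuantumFields-19200), route-R (β) lane ∕ (O2) groundwork — **THE CENTRING-DELTA WITNESS BY KERNEL**:
# the (R-B) per-level term ✓`Prop7CovCombMeanPoincare.sum_normSq_covCombMean_le` does NOT transfer to print's CORNERED comb by re-lettering `off ↦ boxVec` —
# at the flat background `V = 1`, `a = 0` and the constant field `X ≡ 1` the cornered left side is `#T^{(j+1)}·(d(L−1)∕2)² > 0` while the right side is `0`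

Cell `ym3-torus`, width seat `ym3-torus-px5` (gen 5, FILL-TO-CAP «width 5»).  FREE HAND named by ★★OWNER ym3-torus-plan g29 RULING №20 (2)(iv) (2026-08-29 05:37:08Z: «your disprover
test ‹`sum_normSq_covCombMean_le` with `off ↦ boxVec` false at `V = 1, a = 0, X ≡ C`› is a welcome 20-line `example` for any free refuter») on ★ym-routeR-w1 g9's LOCATE #58
`LOCATE-N3COMB-TRANSFER-routeRw1g9.md` §3 («THE LOCATED MATHEMATICAL DELTA — CENTRING»; routeR-w1 05:38:15Z: «the §3 `example` … is free for any refuter»).  THEOREMS ONLY (0 `def`,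
0 `sorry`); `--supports stmt-QuantumFields-19200 --as helper`; count-neutral; label «(O2) groundwork — witness for the located centring delta; not consumed by any displayed row».
YM₃ on T³ is ladder rung R3, NOT the Clay problem; nothing here is a claim about a stub, the crux, d = 4 or the mass gap.  NOTHING IN THE TREE OR IN PRINT IS REFUTED: the (R-B) row is
about the CENTRED comb of [Balaban1987RG1] (0.3)–(0.4) (stairs from the block centre `emb z`, offsets `off r = r − (L−1)∕2`) and stays true; the witness says only that the SAME
inequality with print's CORNERED offsets ([Balaban1985Averaging] (2) p.17, (42) p.23: `boxVec L r = r ≥ 0`, lit ✓`B7Prop1Explicit.boxVec`) is false, so the 13 (R-B) files of the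
symmetric tower need the SPINE SPLIT of LOCATE #58 §3 (cornered tree sum = spine to the midpoint + centred stair + Stokes defects) before they serve the comb tower `hMcomb`∕`hMcomb₂`.

THE MECHANISM (three lit∕tree lemmas + arithmetic).  At `V = 1` the covariant signed sum is the plain one (lit ✓`covWalkSum_one`); along ANY walk a direction-constant field
`b ↦ c_(dir b)` sums to `Σ_κ netDisp_κ • c_κ` (★p1 ✓`Prop7CombMeanCentred.walkSum_dirConst`), and the staircase to offset `n` has `netDisp = n` (lit ✓`netDisp_stairWord`).  With the
CENTRED offsets `Σ_r off r = 0` (✓`sum_off_eq_zero`, `L` odd) and the comb mean of a direction-constant field VANISHES (✓`combMean_dirConst`); with the CORNERED offsets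
`2·Σ_{r ∈ [0,L)^d} r_κ = L^{d−1}·L(L−1)`, so the cornered comb mean of `b ↦ c_(dir b)` is the HALF-DIAGONAL `((L−1)∕2)•Σ_κ c_κ` — print's spine value.  At `X ≡ 1` (`c_κ = 1`) this is
`(d(L−1)∕2)•1 ≠ 0` (`d ≥ 1`, `L ≥ 3`, `N ≥ 1`), while the right side of the (R-B) row at `V = 1`, `a = 0`, `X ≡ 1` is `0` (`1·1·1* − 1 = 0`, `a² = 0`; the hypothesis
`dist1 (plaqHol 1 q) ≤ 0` holds by `dist1 1 = 0`).

WHAT IS PROVED (ns `…Theorems.Prop7CornerCombMeanWitness`; gauge group `SU(N)`, `N ≥ 1`).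
* §1 ★ `covWalkSum_one_walk_dirConst`, ★ `covWalkSum_one_stairWord_dirConst` (flat covariant stair sums of direction-constant fields = `Σ_κ n_κ • c_κ`, ANY offsets).
* §2 ★ `two_mul_sum_fin_coe` (`2·Σ_{t<L} t = L(L−1)`), ★ `two_mul_sum_boxVec` (`2·Σ_r (boxVec L r)_κ = L^{d−1}·L(L−1)`), ★ `sum_boxVec_cast`, ★★ `cornerCombSum_dirConst`,
  ★★ **`cornerCombMean_dirConst`** — the cornered comb mean of `b ↦ c_(dir b)` at `V = 1` is `((L−1)∕2 : ℂ) • Σ_κ c_κ` (vs ✓`combMean_dirConst = 0` for the centred `off`).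
* §3 ★ `dist1_plaqHol_one_le`, ★★ `cornerCombMean_one_ne_zero` (block-level: `(d(L−1)∕2)•1 ≠ 0`), ★★ `sum_normSq_cornerCombMean_one_pos`, and
  ★★★ **`not_sum_normSq_cornerCombMean_le`** — for EVERY `P` (`d ≥ 1`, `L` odd `> 1`), every level `j` and every `N ≥ 1`: the statement of ✓`sum_normSq_covCombMean_le` with
  `off i.1 ↦ boxVec P.L i.1` (everything else VERBATIM) FAILS at `V = 1`, `a = 0`, `X ≡ 1`.
HONEST SCOPE.  Elementary; a witness for a located delta, not an estimate; the cure (spine split) is routeR-w1's F-1∕F-6, not attempted here; nothing of `hMcomb`∕`hMcomb₂`∕(β)∕E′∕EX∕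
the crux; nothing continuum ∕ OS ∕ mass-gap ∕ Clay.

References: T. Bałaban, CMP **109** (1987) 249–301 [Balaban1987RG1] ((0.3)–(0.4) pp.252–253: centred staircases); CMP **98** (1985) 17–51 [Balaban1985Averaging] ((2) p.17, (42)–(43)
p.23, (58) p.27, (62) p.28: cornered blocks and combs); CMP **95** (1984) 17–40 [Balaban1984PropagatorsI] ((1.8) p.19, (1.18)–(1.20) pp.19–20).
-/

set_option autoImplicit false

noncomputable section

open scoped BigOperators Matrix.Norms.L2Operator Matrix

namespace Summit.QuantumFields.YangMills.Theorems.Prop7CornerCombMeanWitness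

open Literature.MathematicalPhysics.QuantumFieldTheory.Balaban1983to89
open T4Continuum BlockAveraging BlockAveragingEMLLinearised BlockAveragingEMLLinearisedBackground LatticeFieldCalculus
open B7Prop1Explicit (boxVec)
open Summit.QuantumFields.YangMills.Theorems.Prop7CombMeanCentred (walkSum_dirConst sum_pi_apply_eq)

variable {P : Params} {j : ℕ} {N : ℕ} [NeZero N]

/-! ## §1 Flat covariant stair sums of direction-constant fields (any offsets) -/

/-- ★ At the flat background the covariant signed sum of a direction-constant field `b ↦ c_(dir b)` along ANY walk is `Σ_κ netDisp_κ • c_κ` (lit ✓`covWalkSum_one` ∘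
✓`walkSum_dirConst`). [cite: Balaban1985Averaging, (58) p.27; Balaban1984PropagatorsI, (1.8) p.19] -/
theorem covWalkSum_one_walk_dirConst (c : Fin P.d → Matrix (Fin N) (Fin N) ℂ) (x : Site P j) (w : List (Letter P.d)) :
    covWalkSum (1 : GaugeField P j (Matrix.specialUnitaryGroup (Fin N) ℂ)) (fun b : PBond P j => c b.dir) (walk x w)
      = ∑ κ : Fin P.d, (netDisp w κ) • c κ := by
  rw [covWalkSum_one, walkSum_dirConst]

/-- ★ Along the staircase to offset `n` (ANY `n : Fin d → ℤ`, centred or cornered) the flat covariant sum of `b ↦ c_(dir b)` is `Σ_κ n_κ • c_κ` (lit ✓`netDisp_stairWord`).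
[cite: Balaban1987RG1, (0.3) p.252; Balaban1984PropagatorsI, (1.8) p.19] -/
theorem covWalkSum_one_stairWord_dirConst (c : Fin P.d → Matrix (Fin N) (Fin N) ℂ) (x : Site P j) (σ : Equiv.Perm (Fin P.d)) (n : Fin P.d → ℤ) :
    covWalkSum (1 : GaugeField P j (Matrix.specialUnitaryGroup (Fin N) ℂ)) (fun b : PBond P j => c b.dir) (walk x (stairWord σ n))
      = ∑ κ : Fin P.d, (n κ) • c κ := by
  rw [covWalkSum_one_walk_dirConst]
  exact Finset.sum_congr rfl fun κ _ => by rw [netDisp_stairWord]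

/-! ## §2 The cornered offsets do NOT average to zero: `2·Σ_{r ∈ [0,L)^d} r_κ = L^{d−1}·L(L−1)`; the cornered comb mean of a direction-constant field is the half-diagonal -/

omit [NeZero N] in
/-- ★ `2·Σ_{t<L} t = L·(L−1)` (as integers). [folklore] -/
theorem two_mul_sum_fin_coe (L : ℕ) : 2 * ∑ t : Fin L, ((t : ℕ) : ℤ) = (L : ℤ) * ((L : ℤ) - 1) := by
  rw [Fin.sum_univ_eq_sum_range (fun t => ((t : ℕ) : ℤ)), ← Nat.cast_sum]
  have h := Finset.sum_range_id_mul_two L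
  have h2 : (2 : ℤ) * ((∑ i ∈ Finset.range L, i : ℕ) : ℤ) = (((∑ i ∈ Finset.range L, i) * 2 : ℕ) : ℤ) := by push_cast; ring
  rw [h2, h]
  rcases Nat.eq_zero_or_pos L with hL | hL
  · subst hL; simp
  · rw [Nat.cast_mul, Nat.cast_sub hL]; push_cast; ring

omit [NeZero N] in
/-- ★ The cornered offsets summed over the offset cube, one coordinate: `2·Σ_{r ∈ [0,L)^d} (boxVec L r)_κ = L^{d−1}·L·(L−1)` (✓`sum_pi_apply_eq`: `L^{d−1}` copies of the
one-dimensional sum). [cite: Balaban1985Averaging, (2) p.17] -/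
theorem two_mul_sum_boxVec (κ : Fin P.d) :
    2 * ∑ r : Fin P.d → Fin P.L, boxVec P.L r κ = ((P.L ^ (P.d - 1) : ℕ) : ℤ) * ((P.L : ℤ) * ((P.L : ℤ) - 1)) := by
  have h := sum_pi_apply_eq (P := P) κ (fun t : Fin P.L => ((t : ℕ) : ℤ))
  simp only [boxVec]
  rw [h, nsmul_eq_mul, mul_left_comm, two_mul_sum_fin_coe]

omit [NeZero N] in
/-- ★ The same in `ℂ`: `Σ_r (boxVec L r)_κ = L^{d−1}·L·(L−1)∕2`. [cite: Balaban1985Averaging, (2) p.17] -/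
theorem sum_boxVec_cast (κ : Fin P.d) :
    ∑ r : Fin P.d → Fin P.L, ((boxVec P.L r κ : ℤ) : ℂ) = (P.L : ℂ) ^ (P.d - 1) * ((P.L : ℂ) * ((P.L : ℂ) - 1)) / 2 := by
  have h := congrArg (fun z : ℤ => (z : ℂ)) (two_mul_sum_boxVec (P := P) κ)
  push_cast at h
  rw [eq_div_iff (two_ne_zero' ℂ)]
  linear_combination h

/-- ★★ **THE CORNERED COMB SUM OF A DIRECTION-CONSTANT FIELD AT THE FLAT BACKGROUND**: `Σ_{i ∈ Idx} Y₁(Γ_{x → x + boxVec i}) = (|S_d|²·L^{d−1}·L(L−1)∕2 : ℂ) • Σ_κ c_κ`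
(✓`sum_idx_of_fst`: the two orderings are dummies). [cite: Balaban1987RG1, (0.4) p.253; Balaban1985Averaging, (42) p.23] -/
theorem cornerCombSum_dirConst (c : Fin P.d → Matrix (Fin N) (Fin N) ℂ) (x : Site P j) :
    ∑ i : Idx P, covWalkSum (1 : GaugeField P j (Matrix.specialUnitaryGroup (Fin N) ℂ)) (fun b : PBond P j => c b.dir) (walk x (stairWord i.2.1 (boxVec P.L i.1)))
      = ((Fintype.card (Equiv.Perm (Fin P.d)) ^ 2 : ℕ) * ((P.L : ℂ) ^ (P.d - 1) * ((P.L : ℂ) * ((P.L : ℂ) - 1)) / 2)) • ∑ κ : Fin P.d, c κ := by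
  simp only [covWalkSum_one_stairWord_dirConst]
  rw [sum_idx_of_fst (fun r : Fin P.d → Fin P.L => ∑ κ : Fin P.d, (boxVec P.L r κ) • c κ), ← Nat.cast_smul_eq_nsmul ℂ, Finset.sum_comm]
  have hκ : ∀ κ : Fin P.d, ∑ r : Fin P.d → Fin P.L, (boxVec P.L r κ) • c κ = ((P.L : ℂ) ^ (P.d - 1) * ((P.L : ℂ) * ((P.L : ℂ) - 1)) / 2) • c κ := fun κ => by
    rw [← sum_boxVec_cast κ, Finset.sum_smul]
    exact Finset.sum_congr rfl fun r _ => (Int.cast_smul_eq_zsmul ℂ _ _).symm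
  rw [Finset.sum_congr rfl fun κ _ => hκ κ, ← Finset.smul_sum, smul_smul]

/-- ★★ **THE CORNERED COMB MEAN OF A DIRECTION-CONSTANT FIELD AT THE FLAT BACKGROUND IS THE HALF-DIAGONAL `((L−1)∕2)•Σ_κ c_κ`** — print's cornered (42)∕(43) comb from the
lowest label (offsets `boxVec L r ∈ [0,L)^d`), versus `0` for the centred comb of [Balaban1987RG1] (0.3)–(0.4) (✓`Prop7CombMeanCentred.combMean_dirConst`).  This is the SPINE value of
LOCATE #58 §3 on constant fields. [cite: Balaban1985Averaging, (2) p.17, (42) p.23, (62) p.28; Balaban1987RG1, (0.3)–(0.4) pp.252–253] -/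
theorem cornerCombMean_dirConst (c : Fin P.d → Matrix (Fin N) (Fin N) ℂ) (z : Site P (j + 1)) :
    ((Fintype.card (Idx P) : ℂ))⁻¹ • ∑ i : Idx P,
        covWalkSum (1 : GaugeField P j (Matrix.specialUnitaryGroup (Fin N) ℂ)) (fun b : PBond P j => c b.dir) (walk (emb z) (stairWord i.2.1 (boxVec P.L i.1)))
      = (((P.L : ℂ) - 1) / 2) • ∑ κ : Fin P.d, c κ := by
  rw [cornerCombSum_dirConst, smul_smul, card_idx]
  congr 1
  have hL : (P.L : ℂ) ≠ 0 := by exact_mod_cast P.L_pos.ne'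
  have hperm : ((Fintype.card (Equiv.Perm (Fin P.d)) : ℂ)) ≠ 0 := by exact_mod_cast Fintype.card_ne_zero
  have hd : (P.L : ℂ) ^ P.d = (P.L : ℂ) ^ (P.d - 1) * P.L := by
    rw [← pow_succ]; congr 1; have := P.hd; omega
  push_cast
  rw [hd]
  field_simp

/-! ## §3 The witness: the (R-B) row with cornered offsets is false at `V = 1`, `a = 0`, `X ≡ 1` -/

/-- ★ The plaquette variables of the flat background are `1`, so the (R-B) hypothesis holds with `a = 0`. [cite: Balaban1985Averaging, (9) p.19] -/
theorem dist1_plaqHol_one_le (q : Plaq P j) :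
    dist1 (GaugeField.plaqHol (1 : GaugeField P j (Matrix.specialUnitaryGroup (Fin N) ℂ)) q) ≤ 0 := by
  have hb : ∀ b : PBond P j, (1 : GaugeField P j (Matrix.specialUnitaryGroup (Fin N) ℂ)) b = 1 := fun _ => rfl
  have h1 : GaugeField.plaqHol (1 : GaugeField P j (Matrix.specialUnitaryGroup (Fin N) ℂ)) q = 1 := by
    rw [GaugeField.plaqHol, hb, hb, hb, hb, inv_one, mul_one, mul_one, mul_one]
  rw [h1, GaugeGroup.dist1_one]

/-- ★★ **BLOCK-LEVEL FACT**: at `V = 1` the cornered comb mean of the constant field `X ≡ 1` at every block is `(d(L−1)∕2)•1 ≠ 0` (`d ≥ 1`, `L ≥ 3`, `N ≥ 1`).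
[cite: Balaban1985Averaging, (42) p.23, (62) p.28] -/
theorem cornerCombMean_one_ne_zero (z : Site P (j + 1)) :
    ((Fintype.card (Idx P) : ℂ))⁻¹ • ∑ i : Idx P,
        covWalkSum (1 : GaugeField P j (Matrix.specialUnitaryGroup (Fin N) ℂ)) (fun _ : PBond P j => (1 : Matrix (Fin N) (Fin N) ℂ))
          (walk (emb z) (stairWord i.2.1 (boxVec P.L i.1))) ≠ 0 := by
  have h := cornerCombMean_dirConst (P := P) (j := j) (fun _ : Fin P.d => (1 : Matrix (Fin N) (Fin N) ℂ)) z
  rw [h, Finset.sum_const, Finset.card_univ, Fintype.card_fin, ← Nat.cast_smul_eq_nsmul ℂ, smul_smul]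
  refine smul_ne_zero ?_ one_ne_zero
  have hL1 : (P.L : ℂ) - 1 ≠ 0 := by
    rw [sub_ne_zero]
    have : P.L ≠ 1 := by have := P.hL.2; omega
    exact_mod_cast this
  have hd : (P.d : ℂ) ≠ 0 := by
    have : P.d ≠ 0 := by have := P.hd; omega
    exact_mod_cast this
  exact mul_ne_zero (div_ne_zero hL1 two_ne_zero) hd

/-- ★★ **THE CORNERED LEFT SIDE IS POSITIVE at `V = 1`, `X ≡ 1`**: `0 < Σ_z ‖cornered comb mean of 1 at z‖²` (one block suffices; `T^{(j+1)}` is inhabited).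
[cite: Balaban1985Averaging, (42) p.23, (62) p.28] -/
theorem sum_normSq_cornerCombMean_one_pos :
    0 < ∑ z : Site P (j + 1), ‖((Fintype.card (Idx P) : ℂ))⁻¹ • ∑ i : Idx P,
        covWalkSum (1 : GaugeField P j (Matrix.specialUnitaryGroup (Fin N) ℂ)) (fun _ : PBond P j => (1 : Matrix (Fin N) (Fin N) ℂ))
          (walk (emb z) (stairWord i.2.1 (boxVec P.L i.1)))‖ ^ 2 := by
  refine Finset.sum_pos' (fun z _ => sq_nonneg _) ⟨default, Finset.mem_univ _, ?_⟩
  exact pow_pos (norm_pos_iff.mpr (cornerCombMean_one_ne_zero (P := P) (j := j) (N := N) default)) 2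

/-- ★★★ **THE WITNESS OF RECORD (★★OWNER RULING №20 (2)(iv); ★routeR-w1 LOCATE #58 §3)**: for every admissible `P` (`d ≥ 1`, `L` odd `> 1`), every level `j` and every `N ≥ 1`, the
statement of ✓`Prop7CovCombMeanPoincare.sum_normSq_covCombMean_le` WITH THE CORNERED OFFSETS `off i.1 ↦ boxVec P.L i.1` (print's (42)∕(43) comb from the lowest label; everything else
verbatim, the level window `j + 1 ≤ m + K` dropped since it is not even needed for the failure) is FALSE — at `V = 1`, `a = 0`, `X ≡ 1` its right side is `0` and its left side is
`#T^{(j+1)}·(d(L−1)∕2)² > 0`.  So the (R-B) row does not transfer to the comb tower by re-lettering: the centring of [Balaban1987RG1] (0.3) (`Σ_r off r = 0`, ✓`sum_off_eq_zero`) is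
used essentially. [cite: Balaban1987RG1, (0.3)–(0.4) pp.252–253; Balaban1985Averaging, (2) p.17, (42) p.23, (62) p.28; Balaban1984PropagatorsI, (1.18)–(1.20) pp.19–20] -/
theorem not_sum_normSq_cornerCombMean_le (P : Params) (j : ℕ) (N : ℕ) [NeZero N] :
    ¬ ∀ (V : GaugeField P j (Matrix.specialUnitaryGroup (Fin N) ℂ)) (a : ℝ), 0 ≤ a →
        (∀ q : Plaq P j, dist1 (GaugeField.plaqHol V q) ≤ a) → ∀ X : PBond P j → Matrix (Fin N) (Fin N) ℂ,
        ∑ z : Site P (j + 1), ‖((Fintype.card (Idx P) : ℂ))⁻¹ • ∑ i : Idx P, covWalkSum V X (walk (emb z) (stairWord i.2.1 (boxVec P.L i.1)))‖ ^ 2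
          ≤ ((P.d : ℝ) + 2) ^ 2 * N * (P.L : ℝ) ^ 4 *
              ∑ b : PBond P j, ∑ ν : Fin P.d,
                ‖((V ⟨b.src, ν⟩ : Matrix.specialUnitaryGroup (Fin N) ℂ) : Matrix (Fin N) (Fin N) ℂ) * X ⟨b.src.shift ν, b.dir⟩
                    * star ((V ⟨b.src, ν⟩ : Matrix.specialUnitaryGroup (Fin N) ℂ) : Matrix (Fin N) (Fin N) ℂ) - X b‖ ^ 2
            + 4 * ((P.d : ℝ) + 2) ^ 2 * (P.d : ℝ) ^ 3 * (3 * N + 2 * P.d) * (P.L : ℝ) ^ 6 * a ^ 2 * ∑ b : PBond P j, ‖X b‖ ^ 2 := by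
  intro h
  have hX := h 1 0 le_rfl dist1_plaqHol_one_le (fun _ => 1)
  -- the right side vanishes: `1·1·1* − 1 = 0` and `a² = 0`
  have hb : ∀ b : PBond P j, (1 : GaugeField P j (Matrix.specialUnitaryGroup (Fin N) ℂ)) b = 1 := fun _ => rfl
  simp only [hb, OneMemClass.coe_one, star_one, mul_one, sub_self, norm_zero, zero_pow two_ne_zero, Finset.sum_const_zero,
    mul_zero, zero_mul, add_zero] at hX
  -- the left side is positive
  exact absurd hX (not_le.mpr sum_normSq_cornerCombMean_one_pos)

end Summit.QuantumFields.YangMills.Theorems.Prop7CornerCombMeanWitness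

end
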